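import Summits.QuantumFields.YangMills.Theorems.BalabanUVNodesN15KingModelContinuumSymbolRate

/-!
# BalabanUVNodes ∕ N15 — THE KING-MODEL RUNG (PART Ϡ-n): KING's (4.5) AT `η = 0` FOR EVERY MOMENTUM `p′ ∈ [−π, π]^d` — the `N`-periodic re-indexing of the uncentred
# alias representatives `{0,…,N−1}^d` (tree `B4Strip`∕`DeltaEff`) onto King's centred digits (`digitBox`, odd `N`), `Δ^{(K)}(p′) = (a_K⁻¹ + S_{L^K}(p′))⁻¹`, hence
# `Δ^{(K)}(p′) → Δ^{(∞)}(p′)` AND LEMMA 4.3's UNIFORM RATE `|Δ^{(K)}(p′) − Δ^{(∞)}(p′)| ≤ C(a)L^{−2K}` AT ALL `p′`, not only torus momenta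
# (Track A, DAG node N15 = NE2; FAN-OUT v1.1 §N15 s3 «KING-MODEL RUNG … NE2's analogue DECIDED in the model»)

HONEST FRAMING.  Count-neutral (cell `pub-ymgap`, seat `pub-ymgap-dag-n15-e` g32; `--supports stmt-QuantumFields-27366 --as helper` = K3⁸
`SpineGivenEndpointR13SepCoPHV`).  TEMPLATE LITERATURE: C. King, *The U(1) Higgs model. I. The continuum limit*, Commun. Math. Phys. **102** (1986) 649–677
[King1986] — KING's OWN `A = 0` MODEL in momentum variables: (4.2)–(4.5) p. 670 with «l ∈ 2πZ^d and −π(L^k − 1) ≦ l_μ ≦ π(L^k − 1) for L odd»; the tree's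
`King1986.DeltaEff a N M p′ = (a⁻¹ + Σ_{m ∈ {0..N−1}^d} Ur N m p′·(DeltaXir N M (p′+2πm))⁻¹)⁻¹` ([Balaban1983RegularityDecay] (2.45) representatives `B4Strip.Ur∕shiftr`), Lemma 4.3
(4.18) p. 672 (`lemma43_aK`), and parts Ϡ-b∕Ϡ-c∕Ϡ-h of the rung.  NOT Bałaban's objects; NOT a node discharge (N15 is booked through n15-a's knit, untouched here); nothing
continuum-Yang–Mills ∕ ℝ⁴ ∕ OS ∕ mass-gap ∕ Clay.  0 `sorry`; standard axioms; 0 `def`.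

THE MATHEMATICS.  Part Ϡ-c obtained `Δ^{(K)}(p′(q)) → Δ^{(∞)}(p′(q))` at TORUS momenta through the fibre dictionary.  For a general `p′ ∈ [−π,π]^d` one compares the two
index sets directly: (i) King's uncentred factor `uFactorr N k x = S₁(x)∕S_{1∕N}(x + 2πk)` IS `‖f_{1∕N}(x + 2πk)‖²` (`|e^{−iy} − 1|² = 4sin²(y∕2)`, `|N(e^{−iy∕N} − 1)|² =
4N²sin²(y∕2N)`; the filled value `1` at `k = 0 = x` matches), so `Ur N m p′ = |u^{1∕N}(p′+2πm)|²` and `DeltaXir = Δ^{1∕N}`; (ii) both factors are `2πN`-PERIODIC in the alias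
momentum away from `0` (`cos` and `sin²` periodicity), so the term at the representative `m_μ ∈ {0..N−1}` equals the term at the CENTRED digit `valMinAbs m_μ ∈
(−N∕2, N∕2]` (`= m_μ` or `m_μ − N`; Mathlib `ZMod.valMinAbs_natCast_of_le_half∕_of_half_lt`); (iii) `m ↦ valMinAbs ∘ m` is a bijection `{0..N−1}^d → digitBox d N` for odd
`N` (inverse `j ↦ val ∘ j`, `ZMod.valMinAbs_spec`).  Hence `Δ^{(K)}(p′) = (a_K⁻¹ + aliasSumN (L^K) m² p′)⁻¹` EXACTLY and part Ϡ-b's Tannery limit + `a_K → a_∞` give the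
limit at every `p′`; Lemma 4.3's geometric steps (part Ϡ-h's `abs_DeltaEff_succ_sub_le`, valid for any `p′ ≠ 0`) and the zero mode give the uniform rate.

WHAT THIS FILE PROVES (kernel).  §1 ★ `norm_sq_uFac_eq` (`‖f_{1∕N}(y)‖² = S₁(y)∕S_{1∕N}(y)`, `y ≠ 0`), ★ **`uFactorr_eq_norm_sq`** (King's filled factor = the squared weight, `|x| ≤ π`),
`Ur_eq_norm_sq_uWeight`, `DeltaXir_shiftr_eq_latticeSymbol`, `composedInvResc_eq_sum_aliasTermAt`.  §2 `S1r_sub_periodic`, `Sxir_sub_periodic`, ★ `norm_uFac_sub_period`,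
`fdSymbol_sub_period` (`2πN`-periodicity).  §3 `norm_uFac_centre`, `fdSymbol_centre`, ★★ `aliasTermAt_centre` (the term at `m` = the term at `valMinAbs ∘ m`), ★★
**`sum_valMinAbs_eq_sum_digitBox`** (the re-indexing bijection, odd `N`).  §4 ★★★ **`DeltaEff_eq_inv_add_aliasSumN`** (`Δ^{(K)}(p′) = (a⁻¹ + S_N(p′))⁻¹`, odd `N`, all `|p′_μ| ≤ π`),
★★★ **`tendsto_DeltaEff_pow_of_abs_le`** (KING's (4.5) AT `η = 0` FOR EVERY `p′ ∈ [−π,π]^d`), ★★★ **`abs_DeltaEff_sub_lim_le_of_abs_le`** (LEMMA 4.3 WITH `n = ∞` AT EVERY `p′`: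
`≤ ((8∕3)a²(a⁻¹+π²∕48+1∕3) + (4∕3)a)·L^{−2K}`, `K ≥ 1`).

HONEST SCOPE.  King's `A = 0` model; odd `L` (King's «for L odd»; even `L` untreated, as in the tree); `a, m² > 0`; `p′` in the closed zone `|p′_μ| ≤ π`.  N15 untouched; counts
unmoved.  Locators: [King1986] (4.2)–(4.5) p.670, Lemma 4.3 (4.18) p.672, (2.13) p.653; [Balaban1983RegularityDecay] (2.44)–(2.46) p.584.
-/

noncomputable section

open Complex Finset Filter Topology

namespace Summit.QuantumFields.YangMills.BalabanUVNodes.N15KingModelRung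

open Literature.MathematicalPhysics.QuantumFieldTheory.Balaban1983to89
open Literature.MathematicalPhysics.QuantumFieldTheory.King1986
open Literature.MathematicalPhysics.QuantumFieldTheory.King1986.Torus (digitBox mem_digitBox two_abs_lt_of_mem_digitBox DeltaEff_zero momSq_pos_of_ne_zero)

variable {d : ℕ}

/-! ## §1 King's uncentred factors ARE the squared weights -/

section Factors

/-- ★ `‖f_{1∕N}(y)‖² = S₁(y)∕S_{1∕N}(y)` for `y ≠ 0` (`|e^{−iy} − 1|² = 4sin²(y∕2)`, `|N(e^{−iy∕N} − 1)|² = 4N²sin²(y∕2N)`). [cite: King1986, (4.3) p.670; Balaban1983RegularityDecay, (2.45) p.584] -/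
theorem norm_sq_uFac_eq {N : ℕ} (hN : N ≠ 0) {y : ℝ} (hy : y ≠ 0) :
    ‖uFac ((N : ℝ)⁻¹) y‖ ^ 2 = B4Strip.S1r y / B4Strip.Sxir N y := by
  have hNr : (0 : ℝ) < N := by exact_mod_cast Nat.pos_of_ne_zero hN
  have hnum : ‖Complex.exp (I * ((-y : ℝ) : ℂ)) - 1‖ ^ 2 = B4Strip.S1r y := by
    rw [Complex.norm_exp_I_mul_ofReal_sub_one, Real.norm_eq_abs, sq_abs, B4Strip.S1r_eq,
      show (-y) / 2 = -(y / 2) by ring, Real.sin_neg]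
    ring
  have hden : ‖fdq ((N : ℝ)⁻¹) y‖ ^ 2 = B4Strip.Sxir N y := by
    unfold fdq
    rw [norm_div, Complex.norm_real, Real.norm_eq_abs, abs_of_pos (inv_pos.mpr hNr), div_pow,
      Complex.norm_exp_I_mul_ofReal_sub_one, Real.norm_eq_abs, sq_abs, B4Strip.Sxir_eq,
      show (-((N : ℝ)⁻¹ * y)) / 2 = -(y / (2 * N)) by field_simp, Real.sin_neg]
    field_simp
    ring
  unfold uFac
  rw [if_neg hy, norm_div, div_pow, hnum, hden]

/-- ★ **KING's FILLED FACTOR IS THE SQUARED WEIGHT**: `uFactorr N k x = ‖f_{1∕N}(x + 2πk)‖²` for `|x| ≤ π`, every `k ∈ ℕ` (the filled value `1` at `k = 0 = x` included).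
[cite: King1986, (4.3) p.670; Balaban1983RegularityDecay, (2.45)–(2.46) p.584] -/
theorem uFactorr_eq_norm_sq {N : ℕ} (hN : N ≠ 0) (k : ℕ) {x : ℝ} (hx : |x| ≤ Real.pi) :
    B4Strip.uFactorr N k x = ‖uFac ((N : ℝ)⁻¹) (x + 2 * Real.pi * k)‖ ^ 2 := by
  by_cases h : k = 0 ∧ x = 0
  · obtain ⟨hk, hx0⟩ := h
    subst hk; subst hx0
    simp [B4Strip.uFactorr, uFac]
  · have hkx : k ≠ 0 ∨ x ≠ 0 := by tauto
    have hy : x + 2 * Real.pi * k ≠ 0 := by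
      rcases Nat.eq_zero_or_pos k with hk | hk
      · subst hk
        have hx0 : x ≠ 0 := by tauto
        simpa using hx0
      · have h1 : (1 : ℝ) ≤ k := by exact_mod_cast hk
        have := (abs_le.mp hx).1
        nlinarith [Real.pi_pos]
    rw [uFactorr_eq_div hkx, norm_sq_uFac_eq hN hy]
    congr 1
    unfold B4Strip.S1r
    rw [show x + 2 * Real.pi * (k : ℝ) = x + k * (2 * Real.pi) by ring, Real.cos_add_nat_mul_two_pi]

/-- `Ur N m p′ = |u^{1∕N}(p′ + 2πm)|²` (`|p′_μ| ≤ π`). [cite: King1986, (4.3) p.670] -/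
theorem Ur_eq_norm_sq_uWeight {N : ℕ} (hN : N ≠ 0) (m : Fin d → Fin N) {p : Fin d → ℝ} (hp : ∀ μ, |p μ| ≤ Real.pi) :
    B4Strip.Ur N m p = ‖uWeight ((N : ℝ)⁻¹) (aliasPt p fun μ => ((m μ : ℕ) : ℤ))‖ ^ 2 := by
  rw [norm_uWeight, ← Finset.prod_pow]
  unfold B4Strip.Ur
  refine Finset.prod_congr rfl fun μ _ => ?_
  rw [uFactorr_eq_norm_sq hN (m μ) (hp μ)]
  simp [aliasPt]

/-- `DeltaXir N M (p′ + 2πm) = Δ^{1∕N}(p′ + 2πm)` in the tree's `latticeSymbol` spelling. [cite: King1986, (4.4) p.670] -/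
theorem DeltaXir_shiftr_eq_latticeSymbol {N : ℕ} (hN : N ≠ 0) (M : ℝ) (m : Fin d → Fin N) (p : Fin d → ℝ) :
    B4Strip.DeltaXir N M (B4Strip.shiftr N m p) = latticeSymbol ((N : ℝ)⁻¹) M (aliasPt p fun μ => ((m μ : ℕ) : ℤ)) := by
  rw [DeltaXir_eq_latticeSymbol hN]
  exact congrArg _ (funext fun μ => by simp [B4Strip.shiftr, aliasPt])

/-- The tree's composed inverse symbol over the UNCENTRED representatives as a sum of part Ϡ-b's alias terms:
`composedInvResc c N M p′ = c + Σ_{m ∈ {0..N−1}^d} aliasTermAt N⁻¹ M p′ m`. [cite: King1986, (4.5) p.670] -/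
theorem composedInvResc_eq_sum_aliasTermAt {N : ℕ} (hN : N ≠ 0) (c M : ℝ) {p : Fin d → ℝ} (hp : ∀ μ, |p μ| ≤ Real.pi) :
    composedInvResc c N M p = c + ∑ m : Fin d → Fin N, aliasTermAt ((N : ℝ)⁻¹) M p (fun μ => ((m μ : ℕ) : ℤ)) := by
  unfold composedInvResc aliasTermAt
  congr 1
  refine Finset.sum_congr rfl fun m _ => ?_
  rw [Ur_eq_norm_sq_uWeight hN m hp, DeltaXir_shiftr_eq_latticeSymbol hN M m p, div_eq_mul_inv]

end Factors

/-! ## §2 `2πN`-periodicity of the factors in the alias momentum -/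

section Periodic

/-- `S₁(y − 2πN) = S₁(y)`. [folklore] -/
theorem S1r_sub_periodic (y : ℝ) (N : ℕ) : B4Strip.S1r (y - 2 * Real.pi * N) = B4Strip.S1r y := by
  unfold B4Strip.S1r
  rw [show y - 2 * Real.pi * (N : ℝ) = y - N * (2 * Real.pi) by ring, Real.cos_sub_nat_mul_two_pi]

/-- `S_{1∕N}(y − 2πN) = S_{1∕N}(y)`. [folklore] -/
theorem Sxir_sub_periodic {N : ℕ} (hN : N ≠ 0) (y : ℝ) : B4Strip.Sxir N (y - 2 * Real.pi * N) = B4Strip.Sxir N y := by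
  have hNr : (N : ℝ) ≠ 0 := by exact_mod_cast hN
  unfold B4Strip.Sxir
  rw [show (y - 2 * Real.pi * (N : ℝ)) / N = y / N - 2 * Real.pi by field_simp, Real.cos_sub_two_pi]

/-- ★ `‖f_{1∕N}(y − 2πN)‖ = ‖f_{1∕N}(y)‖` when `y ≠ 0 ≠ y − 2πN`. [cite: King1986, (4.3) p.670] -/
theorem norm_uFac_sub_period {N : ℕ} (hN : N ≠ 0) {y : ℝ} (hy : y ≠ 0) (hy' : y - 2 * Real.pi * N ≠ 0) :
    ‖uFac ((N : ℝ)⁻¹) (y - 2 * Real.pi * N)‖ = ‖uFac ((N : ℝ)⁻¹) y‖ := by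
  rw [← sq_eq_sq₀ (norm_nonneg _) (norm_nonneg _), norm_sq_uFac_eq hN hy', norm_sq_uFac_eq hN hy, S1r_sub_periodic, Sxir_sub_periodic hN]

/-- `Δ`-factor periodicity: `fdSymbol N⁻¹ (y − 2πN) = fdSymbol N⁻¹ y`. [cite: King1986, (4.4) p.670] -/
theorem fdSymbol_sub_period {N : ℕ} (hN : N ≠ 0) (y : ℝ) : fdSymbol ((N : ℝ)⁻¹) (y - 2 * Real.pi * N) = fdSymbol ((N : ℝ)⁻¹) y := by
  rw [← Sxir_eq_fdSymbol hN, ← Sxir_eq_fdSymbol hN, Sxir_sub_periodic hN]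

end Periodic

/-! ## §3 Centring the representatives: `m_μ ↦ valMinAbs m_μ` -/

section Centre

/-- The centred digit of a representative `k < N`: `valMinAbs k = k` (`k ≤ N∕2`) or `k − N` (`N∕2 < k`). [cite: King1986, (4.2) p.670] -/
theorem valMinAbs_cases {N : ℕ} (k : Fin N) :
    (((k : ℕ) : ZMod N)).valMinAbs = ((k : ℕ) : ℤ) ∨ ((((k : ℕ) : ZMod N)).valMinAbs = ((k : ℕ) : ℤ) - N ∧ N / 2 < (k : ℕ)) := by
  by_cases h : (k : ℕ) ≤ N / 2
  · exact Or.inl (ZMod.valMinAbs_natCast_of_le_half h)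
  · push Not at h
    exact Or.inr ⟨ZMod.valMinAbs_natCast_of_half_lt h k.isLt, h⟩

/-- One coordinate of the weight at the representative = at the centred digit (`|x| ≤ π`). [cite: King1986, (4.2)–(4.3) p.670] -/
theorem norm_uFac_centre {N : ℕ} (hN : N ≠ 0) {x : ℝ} (hx : |x| ≤ Real.pi) (k : Fin N) :
    ‖uFac ((N : ℝ)⁻¹) (x + 2 * Real.pi * ((((((k : ℕ) : ZMod N)).valMinAbs : ℤ) : ℝ)))‖ = ‖uFac ((N : ℝ)⁻¹) (x + 2 * Real.pi * ((k : ℕ) : ℝ))‖ := by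
  rcases valMinAbs_cases k with h | ⟨h, hk⟩
  · rw [h, Int.cast_natCast]
  · rw [h]
    push_cast
    have hk1 : (1 : ℝ) ≤ (k : ℕ) := by exact_mod_cast (show 1 ≤ (k : ℕ) by omega)
    have hkN : ((k : ℕ) : ℝ) + 1 ≤ N := by exact_mod_cast (show (k : ℕ) + 1 ≤ N from k.isLt)
    have hxl := (abs_le.mp hx).1
    have hxu := (abs_le.mp hx).2
    have hy : x + 2 * Real.pi * ((k : ℕ) : ℝ) ≠ 0 := by nlinarith [Real.pi_pos]
    have hy' : x + 2 * Real.pi * ((k : ℕ) : ℝ) - 2 * Real.pi * N ≠ 0 := by nlinarith [Real.pi_pos]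
    rw [show x + 2 * Real.pi * (((k : ℕ) : ℝ) - N) = x + 2 * Real.pi * ((k : ℕ) : ℝ) - 2 * Real.pi * N by ring]
    exact norm_uFac_sub_period hN hy hy'

/-- One coordinate of the symbol at the representative = at the centred digit. [cite: King1986, (4.2)–(4.4) p.670] -/
theorem fdSymbol_centre {N : ℕ} (hN : N ≠ 0) (x : ℝ) (k : Fin N) :
    fdSymbol ((N : ℝ)⁻¹) (x + 2 * Real.pi * ((((((k : ℕ) : ZMod N)).valMinAbs : ℤ) : ℝ))) = fdSymbol ((N : ℝ)⁻¹) (x + 2 * Real.pi * ((k : ℕ) : ℝ)) := by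
  rcases valMinAbs_cases k with h | ⟨h, _⟩
  · rw [h, Int.cast_natCast]
  · rw [h]
    push_cast
    rw [show x + 2 * Real.pi * (((k : ℕ) : ℝ) - N) = x + 2 * Real.pi * ((k : ℕ) : ℝ) - 2 * Real.pi * N by ring]
    exact fdSymbol_sub_period hN _

/-- ★★ **THE ALIAS TERM AT A REPRESENTATIVE IS THE TERM AT ITS CENTRED DIGIT**: `aliasTermAt N⁻¹ M p′ m = aliasTermAt N⁻¹ M p′ (valMinAbs ∘ m)` (`|p′_μ| ≤ π`).
[cite: King1986, (4.2)–(4.5) p.670] -/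
theorem aliasTermAt_centre {N : ℕ} (hN : N ≠ 0) (M : ℝ) {p : Fin d → ℝ} (hp : ∀ μ, |p μ| ≤ Real.pi) (m : Fin d → Fin N) :
    aliasTermAt ((N : ℝ)⁻¹) M p (fun μ => ((m μ : ℕ) : ℤ))
      = aliasTermAt ((N : ℝ)⁻¹) M p (fun μ => (((m μ : ℕ) : ZMod N)).valMinAbs) := by
  unfold aliasTermAt
  rw [norm_uWeight, norm_uWeight]
  unfold latticeSymbol
  congr 1
  · congr 1
    refine Finset.prod_congr rfl fun μ _ => ?_
    simp only [aliasPt]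
    push_cast
    exact (norm_uFac_centre hN (hp μ) (m μ)).symm
  · congr 1
    refine Finset.sum_congr rfl fun μ _ => ?_
    simp only [aliasPt]
    push_cast
    exact (fdSymbol_centre hN (p μ) (m μ)).symm

/-- ★★ **THE RE-INDEXING BIJECTION**: for odd `N`, `Σ_{m ∈ {0..N−1}^d} F(valMinAbs ∘ m) = Σ_{j ∈ digitBox d N} F(j)` (inverse `j ↦ val ∘ j`).
[cite: King1986, (4.2) p.670 («for L odd»)] -/
theorem sum_valMinAbs_eq_sum_digitBox {N : ℕ} (hN : Odd N) (F : (Fin d → ℤ) → ℝ) :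
    ∑ m : Fin d → Fin N, F (fun μ => (((m μ : ℕ) : ZMod N)).valMinAbs) = ∑ j ∈ digitBox d N, F j := by
  haveI : NeZero N := ⟨by obtain ⟨t, ht⟩ := hN; omega⟩
  refine Finset.sum_nbij' (fun m => fun μ => (((m μ : ℕ) : ZMod N)).valMinAbs)
    (fun j => fun μ => ⟨((j μ : ZMod N)).val, ZMod.val_lt _⟩) ?_ ?_ ?_ ?_ ?_
  · intro m _
    refine (mem_digitBox N).mpr fun μ => ?_
    have h := ZMod.natAbs_valMinAbs_le (((m μ : ℕ) : ZMod N))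
    rw [Int.abs_eq_natAbs]
    exact_mod_cast h
  · intro j _
    exact Finset.mem_univ _
  · intro m _
    funext μ
    apply Fin.ext
    show ((((((m μ : ℕ) : ZMod N)).valMinAbs : ℤ) : ZMod N)).val = (m μ : ℕ)
    rw [ZMod.coe_valMinAbs, ZMod.val_natCast, Nat.mod_eq_of_lt (m μ).isLt]
  · intro j hj
    funext μ
    show (((((j μ : ℤ) : ZMod N)).val : ℕ) : ZMod N).valMinAbs = j μ
    rw [ZMod.natCast_zmod_val]
    refine (ZMod.valMinAbs_spec _ _).mpr ⟨rfl, ?_⟩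
    have h2 := two_abs_lt_of_mem_digitBox N hN hj μ
    simp only [Set.mem_Ioc]
    rcases abs_cases (j μ) with ⟨h, _⟩ | ⟨h, _⟩ <;> rw [h] at h2 <;> constructor <;> omega
  · intro m _
    rfl

end Centre

/-! ## §4 (4.5) at `η = 0` for every momentum of the zone -/

section AllMomenta

/-- ★★★ **`Δ^{(K)}(p′) = (a⁻¹ + S_N(p′))⁻¹`** for odd `N` and every `p′` with `|p′_μ| ≤ π`: the tree's uncentred representation of (4.5) IS part Ϡ-b's digit sum.
[cite: King1986, (4.5) p.670] -/
theorem DeltaEff_eq_inv_add_aliasSumN {N : ℕ} (hN : Odd N) (a M : ℝ) {p : Fin d → ℝ} (hp : ∀ μ, |p μ| ≤ Real.pi) :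
    DeltaEff a N M p = (a⁻¹ + aliasSumN N M p)⁻¹ := by
  have hN0 : N ≠ 0 := by obtain ⟨t, ht⟩ := hN; omega
  unfold DeltaEff aliasSumN
  rw [composedInvResc_eq_sum_aliasTermAt hN0 a⁻¹ M hp]
  congr 2
  rw [Finset.sum_congr rfl fun m _ => aliasTermAt_centre hN0 M hp m]
  exact sum_valMinAbs_eq_sum_digitBox hN (fun j => aliasTermAt ((N : ℝ)⁻¹) M p j)

variable (L : ℕ)

/-- ★★★ **KING's (4.5) AT `η = 0` FOR EVERY MOMENTUM OF THE ZONE**: for `L` odd `≥ 2`, `a, m² > 0` and every `p′` with `|p′_μ| ≤ π`,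
`Δ^{(K)}(p′) = DeltaEff a_K L^K m² p′ → Δ^{(∞)}(p′) = (a_∞⁻¹ + Σ_{j∈ℤ^d}|u⁰(p′+2πj)|²∕(|p′+2πj|²+m²))⁻¹` as `K → ∞`. [cite: King1986, (4.5) p.670, (2.13) p.653] -/
theorem tendsto_DeltaEff_pow_of_abs_le (hLodd : Odd L) (hL : 2 ≤ L) {a m2 : ℝ} (ha : 0 < a) (hm : 0 < m2) {p : Fin d → ℝ} (hp : ∀ μ, |p μ| ≤ Real.pi) :
    Tendsto (fun K : ℕ => DeltaEff (aK a L K) (L ^ K) m2 p) atTop (𝓝 (effSymLim a L m2 p)) := by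
  have hL1 : (1 : ℝ) < L := by exact_mod_cast (show 1 < L by omega)
  have hS := tendsto_aliasSumN_pow (d := d) hLodd hL hm hp
  have haK := tendsto_inv_aK (L := (L : ℝ)) ha hL1
  have hne : (aInf a L)⁻¹ + aliasSeries0 m2 p ≠ 0 := by
    have h1 := aInf_pos ha hL1
    have h2 := aliasSeries0_nonneg (d := d) hm.le p
    positivity
  rw [effSymLim_eq_inv ha hL1 hm.le p]
  refine ((haK.add hS).inv₀ hne).congr fun K => ?_
  exact (DeltaEff_eq_inv_add_aliasSumN hLodd.pow (aK a L K) m2 hp).symm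

/-- ★★★ **LEMMA 4.3 WITH `n = ∞` AT EVERY MOMENTUM OF THE ZONE**: for `L` odd `≥ 2`, `a, m² > 0`, `K ≥ 1` and every `p′` with `|p′_μ| ≤ π`,
`|Δ^{(K)}(p′) − Δ^{(∞)}(p′)| ≤ ((8∕3)a²(a⁻¹ + π²∕48 + 1∕3) + (4∕3)a)·L^{−2K}`. [cite: King1986, Lemma 4.3 (4.18) p.672, (4.5) p.670] -/
theorem abs_DeltaEff_sub_lim_le_of_abs_le (hLodd : Odd L) (hL : 2 ≤ L) {a m2 : ℝ} (ha : 0 < a) (hm : 0 < m2) {K : ℕ} (hK : 1 ≤ K) {p : Fin d → ℝ}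
    (hp : ∀ μ, |p μ| ≤ Real.pi) :
    |DeltaEff (aK a L K) (L ^ K) m2 p - effSymLim a L m2 p|
      ≤ (8 / 3 * (a ^ 2 * (a⁻¹ + Real.pi ^ 2 / 48 + 1 / 3)) + 4 / 3 * a) * ((L : ℝ) ^ (2 * K))⁻¹ := by
  haveI : NeZero L := ⟨by omega⟩
  have hL1 : (1 : ℝ) < L := by exact_mod_cast (show 1 < L by omega)
  have hL2r : (2 : ℝ) ≤ L := by exact_mod_cast hL
  have hx0 : 0 ≤ ((L : ℝ) ^ (2 * K))⁻¹ := by positivity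
  have hA : 0 ≤ 8 / 3 * (a ^ 2 * (a⁻¹ + Real.pi ^ 2 / 48 + 1 / 3)) := by positivity
  have hB : 0 ≤ 4 / 3 * a := by positivity
  by_cases hp0 : p = 0
  · -- the zero mode
    subst hp0
    rw [DeltaEff_zero, effSymLim_zero ha hL1 hm]
    obtain ⟨_, h2⟩ := aK_sub_aInf_le L hL ha hK
    calc _ ≤ |aK a L K - aInf a L| := abs_invAddInv_sub_le (aK_pos ha hL1 hK) (aInf_pos ha hL1) (by positivity)
      _ ≤ 4 / 3 * a * ((L : ℝ) ^ (2 * K))⁻¹ := by rw [abs_of_nonneg (by linarith [aInf_le_aK ha hL1 hK])]; exact h2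
      _ ≤ _ := by nlinarith
  · -- nonzero momentum: Lemma 4.3's geometric steps summed to the limit
    have hpos : 0 < momSq p := momSq_pos_of_ne_zero hp0
    set C := 2 * a ^ 2 * (a⁻¹ + Real.pi ^ 2 / 48 + 1 / 3) with hC
    set r := ((L : ℝ) ^ 2)⁻¹ with hr
    set f : ℕ → ℝ := fun n => DeltaEff (aK a L (n + 1)) (L ^ (n + 1)) m2 p with hf
    have hL2 : 1 < (L : ℝ) ^ 2 := by nlinarith
    have hr1 : r < 1 := inv_lt_one_of_one_lt₀ hL2
    have hC0 : 0 ≤ C := by positivity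
    have hstep : ∀ n, dist (f n) (f (n + 1)) ≤ C * r * r ^ n := by
      intro n
      rw [Real.dist_eq]
      have h := abs_DeltaEff_succ_sub_le L hL ha hm (K := n + 1) (by omega) hp hpos
      calc _ ≤ C * r ^ (n + 1) := h
        _ = C * r * r ^ n := by rw [pow_succ]; ring
    have hlim : Tendsto f atTop (𝓝 (effSymLim a L m2 p)) :=
      (tendsto_DeltaEff_pow_of_abs_le L hLodd hL ha hm hp).comp (tendsto_add_atTop_nat 1)
    have hgeo := dist_le_of_le_geometric_of_tendsto r (C * r) hr1 hstep hlim (K - 1)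
    have hfK : f (K - 1) = DeltaEff (aK a L K) (L ^ K) m2 p := by
      simp only [hf, Nat.sub_add_cancel hK]
    rw [hfK, Real.dist_eq] at hgeo
    have hden : 0 < 1 - r := by linarith
    have hr4 : r ≤ 4⁻¹ := by
      rw [hr]
      exact inv_anti₀ (by norm_num) (by nlinarith [hL2r])
    have hq' : 1 / (1 - r) ≤ 4 / 3 := by
      rw [div_le_div_iff₀ hden (by norm_num)]
      linarith
    have hrK : r * r ^ (K - 1) = ((L : ℝ) ^ (2 * K))⁻¹ := by
      rw [← pow_succ', Nat.sub_add_cancel hK, hr, ← inv_pow, ← pow_mul, inv_pow]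
    calc |DeltaEff (aK a L K) (L ^ K) m2 p - effSymLim a L m2 p|
        ≤ C * r * r ^ (K - 1) / (1 - r) := hgeo
      _ = C * ((L : ℝ) ^ (2 * K))⁻¹ * (1 / (1 - r)) := by rw [mul_assoc C, hrK]; ring
      _ ≤ C * ((L : ℝ) ^ (2 * K))⁻¹ * (4 / 3) := mul_le_mul_of_nonneg_left hq' (by positivity)
      _ = 8 / 3 * (a ^ 2 * (a⁻¹ + Real.pi ^ 2 / 48 + 1 / 3)) * ((L : ℝ) ^ (2 * K))⁻¹ := by rw [hC]; ring
      _ ≤ _ := by nlinarith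

end AllMomenta

end Summit.QuantumFields.YangMills.BalabanUVNodes.N15KingModelRung

end
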